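import Mathlib
import Literature.NumberTheory.LFunctions.Zhang2022.Section4Eq46Holds
import Literature.NumberTheory.LFunctions.Zhang2022.Section4Lemma45
import Literature.NumberTheory.LFunctions.Zhang2022.Section2AnalyticRootY
import HarnessLib

/-!
# Zhang (2022) §2 (2.4)/(2.5): the size of `Z(s,θ)` and `Z(s,θ)⁻¹` on BOTH sides of the critical
# line — `|Z(s,θ)| ≍ (kt/2π)^{1/2−σ}` on `|σ − ½| ≤ A`, `t ≫ A²`

Topic `Literature/NumberTheory/LFunctions/Zhang2022` (Landau–Siegel audit tree; verdict-neutral).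
Y. Zhang, *Discrete mean estimates and the Landau–Siegel zero*, arXiv:2211.02515v1 (2022)
[Zhang2022LandauSiegel] — **an unrefereed manuscript under adjudication; nothing in this file asserts or
denies its Theorems 1–2.** The factor `Z(s,θ)` of the functional equation `L(s,θ) = Z(s,θ)L(1−s,θ̄)`
(2.2) satisfies, by Stirling's formula, `Z(s,θ) = θ(−1)τ(θ)k^{−s}ϑ(s)(1 + O(e^{−πt}))` (2.4) and hence
`|Z(σ+it,θ)| ≍ (kt/2π)^{1/2−σ}` uniformly for `|σ| ≪ t` — the "simple estimation" behind every far-left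
contour move of the manuscript (§7 (7.18)–(7.19), §15 p. 80 (`𝔍(−α) → 𝔍(−1)`), §16 p. 89 u004
(`𝔍(−α) → 𝔍(−𝓛⁹)`), §17 (17.7)). The tree has the one-sided form
`Section7aStatements.norm_Zfac_inv_le` (`|Z⁻¹| ≤ e³(pt₀)^{σ−½}` for `σ ≥ ½`); this file proves the
TWO-SIDED sharp form, generic in the primitive character:

* `norm_Zfac_and_inv_le` — for `θ` primitive mod `k`, `1 ≤ A`, `|σ − ½| ≤ A`, `t ≥ 2(A+2)` and
  `|σ − ½|(2A+9) ≤ t`:  `‖Z(s,θ)‖ ≤ e·(kt/2π)^{½−σ}` and `‖Z(s,θ)⁻¹‖ ≤ e·(kt/2π)^{σ−½}`.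

Proof: `Z(σ+it) = Z(½+it)·exp(w∫₀¹(Z′/Z)(½+rw+it)dr)` with `w = σ − ½` (the tree's
`Lemma45.eq_mul_exp_integral_logDeriv_segment`; `Z` analytic and zero-free on `Im s > 0`), `|Z(½+it)| = 1`
(`GammaFactor.norm_Zfac_half_eq_one`), and `(Z′/Z)(u+it) = −log(kt/2π) + O((2A+9)/t)` on `|u| ≤ A+1`
(the tree's two-sided Stirling bound `GammaFactor.norm_logDeriv_Zfac_add_log_le_of_abs_le`); so
`log|Z(s)| = −w·log(kt/2π) + O(|w|(2A+9)/t)` with either sign of `w`. Theorems only; no definitions, no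
named facts; axioms standard. WHAT THIS IS NOT: anything about `L(s,θ)` itself or about Theorems 1–2 of
the source.

## References

* Y. Zhang, arXiv:2211.02515v1 (2022), §2 (2.4)–(2.5) p. 7; §16 p. 89 (u004).
  [cite: Zhang2022LandauSiegel, §2 (2.4)–(2.5) p.7]
* H. L. Montgomery, R. C. Vaughan, *Multiplicative Number Theory I* (2007), §10.1, Cor. 10.5 / (10.35)
  (Stirling for the Γ-quotient). [cite: MontgomeryVaughan2007, §10.1 Cor. 10.5]
-/

noncomputable section

open Complex Real Set MeasureTheory intervalIntegral

namespace Literature.NumberTheory.LFunctions.Zhang2022.GammaFactor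

variable {k : ℕ} [NeZero k]

/-- **`|Z(s,θ)| ≍ (kt/2π)^{1/2−σ}` on both sides of the critical line.** For `θ` primitive mod `k`,
`1 ≤ A`, `s = σ + it` with `|σ − ½| ≤ A`, `t ≥ 2(A+2)` and `|σ − ½|·(2A+9) ≤ t`:
`‖Z(s,θ)‖ ≤ e·(kt/2π)^{½−σ}` and `‖Z(s,θ)⁻¹‖ ≤ e·(kt/2π)^{σ−½}`.
[cite: Zhang2022LandauSiegel, §2 (2.4)–(2.5) p.7] -/
theorem norm_Zfac_and_inv_le {θ : DirichletCharacter ℂ k} (hθ : θ.IsPrimitive) {A : ℝ} (hA : 1 ≤ A)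
    {s : ℂ} (hσ : |s.re - 1 / 2| ≤ A) (ht : 2 * (A + 2) ≤ s.im)
    (hδ : |s.re - 1 / 2| * (2 * A + 9) ≤ s.im) :
    ‖Zfac θ s‖ ≤ Real.exp 1 * ((k : ℝ) * s.im / (2 * π)) ^ (1 / 2 - s.re) ∧
      ‖(Zfac θ s)⁻¹‖ ≤ Real.exp 1 * ((k : ℝ) * s.im / (2 * π)) ^ (s.re - 1 / 2) := by
  have hk : (0 : ℝ) < k := Nat.cast_pos.mpr (Nat.pos_of_ne_zero (NeZero.ne k))
  have hπ := Real.pi_pos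
  set σ := s.re with hσdef
  set t := s.im with htdef
  have ht0 : 0 < t := by linarith
  have hbase : 0 < (k : ℝ) * t / (2 * π) := by positivity
  -- the segment from `a = ½ + it` to `s`: `s = a + w`, `w = σ − ½` real
  set wr : ℝ := σ - 1 / 2 with hwr
  set w : ℂ := (wr : ℂ) with hw
  set a : ℂ := (1 / 2 : ℂ) + t * I with ha
  have hpt : ∀ r : ℝ, a + (r : ℂ) * w = ((1 / 2 + r * wr : ℝ) : ℂ) + t * I := by
    intro r; rw [ha, hw]; push_cast; ring
  have him : ∀ r : ℝ, (a + (r : ℂ) * w).im = t := by intro r; rw [hpt]; simp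
  have himpos : ∀ r : ℝ, 0 < (a + (r : ℂ) * w).im := fun r => by rw [him]; exact ht0
  have hg : ∀ r ∈ Icc (0 : ℝ) 1, AnalyticAt ℂ (Zfac θ) (a + r * w) :=
    fun r _ => analyticAt_Zfac θ (himpos r)
  have h0 : ∀ r ∈ Icc (0 : ℝ) 1, Zfac θ (a + r * w) ≠ 0 :=
    fun r _ => Zfac_ne_zero hθ (himpos r)
  have key := Lemma45.eq_mul_exp_integral_logDeriv_segment hg h0
  have haw : a + w = s := by
    rw [ha, hw, hwr]; apply Complex.ext <;> simp [hσdef, htdef]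
  have ha1 : ‖Zfac θ a‖ = 1 := by rw [ha]; exact norm_Zfac_half_eq_one hθ ht0
  -- Stirling along the segment
  set L : ℝ := Real.log ((k : ℝ) * t / (2 * π)) with hL
  set δ : ℝ := (2 * (A + 1) + 7) / t with hδdef
  have hδ0 : 0 ≤ δ := by rw [hδdef]; positivity
  set f : ℝ → ℂ := fun r => deriv (Zfac θ) (a + r * w) / Zfac θ (a + r * w) with hf
  have hpw : ∀ r ∈ Icc (0 : ℝ) 1, ‖f r + (L : ℂ)‖ ≤ δ := by
    intro r hr
    have hr' : |r * wr| ≤ A := by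
      rw [abs_mul, abs_of_nonneg hr.1]
      calc r * |wr| ≤ 1 * |wr| := mul_le_mul_of_nonneg_right hr.2 (abs_nonneg _)
        _ ≤ A := by rw [one_mul, hwr]; exact hσ
    have hu : |1 / 2 + r * wr| ≤ A + 1 := by
      have := abs_add_le (1 / 2 : ℝ) (r * wr)
      have h12 : |(1 / 2 : ℝ)| = 1 / 2 := abs_of_pos (by norm_num)
      linarith
    have hA1 : 1 ≤ A + 1 := by linarith
    have hlog := norm_logDeriv_Zfac_add_log_le_of_abs_le hθ (A := A + 1) (σ := 1 / 2 + r * wr)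
      (t := t) hA1 hu (by linarith)
    rw [← hpt r, logDeriv_apply] at hlog
    simpa [hf, hL, hδdef] using hlog
  -- continuity of the integrand along the segment (for integrability)
  have hcont : ContinuousOn f (Set.uIcc 0 1) := by
    intro r hr
    rw [Set.uIcc_of_le zero_le_one] at hr
    have hpath : Continuous fun r : ℝ => a + (r : ℂ) * w := by fun_prop
    have hZan : AnalyticAt ℂ (Zfac θ) (a + r * w) := hg r hr
    have h1 : ContinuousAt (fun r : ℝ => deriv (Zfac θ) (a + r * w)) r :=
      ContinuousAt.comp (g := deriv (Zfac θ)) (f := fun r : ℝ => a + (r : ℂ) * w)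
        hZan.deriv.continuousAt hpath.continuousAt
    have h2 : ContinuousAt (fun r : ℝ => Zfac θ (a + r * w)) r :=
      ContinuousAt.comp (g := Zfac θ) (f := fun r : ℝ => a + (r : ℂ) * w)
        hZan.continuousAt hpath.continuousAt
    exact (h1.div h2 (h0 r hr)).continuousWithinAt
  have hint_f : IntervalIntegrable f volume 0 1 := hcont.intervalIntegrable
  -- `‖∫₀¹ f + L‖ ≤ δ`
  set J : ℂ := ∫ r in (0 : ℝ)..1, f r with hJ
  have hJL : ‖J + (L : ℂ)‖ ≤ δ := by
    have hsum : (∫ r in (0 : ℝ)..1, (f r + (L : ℂ))) = J + (L : ℂ) := by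
      rw [intervalIntegral.integral_add hint_f intervalIntegrable_const, hJ]
      simp
    have hb := intervalIntegral.norm_integral_le_of_norm_le_const (a := (0 : ℝ)) (b := 1)
      (f := fun r => f r + (L : ℂ)) (C := δ) (fun r hr => hpw r (by
        rw [Set.uIoc_of_le zero_le_one] at hr; exact ⟨hr.1.le, hr.2⟩))
    rw [hsum] at hb
    simpa using hb
  have hReJ : |J.re + L| ≤ δ := by
    have h := Complex.abs_re_le_norm (J + (L : ℂ))
    rw [Complex.add_re, Complex.ofReal_re] at h
    exact h.trans hJL
  obtain ⟨hRe1, hRe2⟩ := abs_le.mp hReJ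
  -- the exponent bounds: `w·Re J ≤ |w|δ − wL`, `−w·Re J ≤ |w|δ + wL`, and `|w|δ ≤ 1`
  have hwabs : |wr| * (2 * A + 9) ≤ t := by rw [hwr]; exact hδ
  have hwδ : |wr| * δ ≤ 1 := by
    rw [hδdef, show 2 * (A + 1) + 7 = 2 * A + 9 by ring, ← mul_div_assoc, div_le_one ht0]
    exact hwabs
  have hprod1 : wr * J.re ≤ |wr| * δ - wr * L := by
    have : wr * (J.re + L) ≤ |wr| * δ := by
      calc wr * (J.re + L) ≤ |wr * (J.re + L)| := le_abs_self _
        _ = |wr| * |J.re + L| := abs_mul _ _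
        _ ≤ |wr| * δ := mul_le_mul_of_nonneg_left hReJ (abs_nonneg _)
    linarith
  have hprod2 : -(wr * J.re) ≤ |wr| * δ + wr * L := by
    have : -(wr * (J.re + L)) ≤ |wr| * δ := by
      calc -(wr * (J.re + L)) ≤ |wr * (J.re + L)| := neg_le_abs _
        _ = |wr| * |J.re + L| := abs_mul _ _
        _ ≤ |wr| * δ := mul_le_mul_of_nonneg_left hReJ (abs_nonneg _)
    linarith
  -- `Z(s) = Z(a)·exp(wJ)`, `|Z(a)| = 1`, `Re(wJ) = w·Re J`
  have hZs : Zfac θ s = Zfac θ a * Complex.exp (w * J) := by rw [← haw, key]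
  have hre_wJ : (w * J).re = wr * J.re := by
    rw [hw, Complex.re_ofReal_mul]
  have hnormZ : ‖Zfac θ s‖ = Real.exp (wr * J.re) := by
    rw [hZs, norm_mul, ha1, one_mul, Complex.norm_exp, hre_wJ]
  have hrpow1 : Real.exp (-(wr * L)) = ((k : ℝ) * t / (2 * π)) ^ (1 / 2 - σ) := by
    rw [Real.rpow_def_of_pos hbase, ← hL]; congr 1; rw [hwr]; ring
  have hrpow2 : Real.exp (wr * L) = ((k : ℝ) * t / (2 * π)) ^ (σ - 1 / 2) := by
    rw [Real.rpow_def_of_pos hbase, ← hL]; congr 1; rw [hwr]; ring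
  have he : Real.exp (|wr| * δ) ≤ Real.exp 1 := Real.exp_le_exp.mpr hwδ
  constructor
  · rw [hnormZ]
    calc Real.exp (wr * J.re) ≤ Real.exp (|wr| * δ - wr * L) := Real.exp_le_exp.mpr hprod1
      _ = Real.exp (|wr| * δ) * Real.exp (-(wr * L)) := by rw [← Real.exp_add]; ring_nf
      _ ≤ Real.exp 1 * ((k : ℝ) * t / (2 * π)) ^ (1 / 2 - σ) := by
          rw [hrpow1]; exact mul_le_mul_of_nonneg_right he (Real.rpow_nonneg hbase.le _)
  · rw [norm_inv, hnormZ, ← Real.exp_neg]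
    calc Real.exp (-(wr * J.re)) ≤ Real.exp (|wr| * δ + wr * L) := Real.exp_le_exp.mpr hprod2
      _ = Real.exp (|wr| * δ) * Real.exp (wr * L) := by rw [← Real.exp_add]
      _ ≤ Real.exp 1 * ((k : ℝ) * t / (2 * π)) ^ (σ - 1 / 2) := by
          rw [hrpow2]; exact mul_le_mul_of_nonneg_right he (Real.rpow_nonneg hbase.le _)

end Literature.NumberTheory.LFunctions.Zhang2022.GammaFactor
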